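import Mathlib
import Summits.KontsevichZagierPeriods.KontsevichZagierPeriods.Theorems.TorsionLogsNeronTorsionSectorStubDlogUnfold
import Summits.KontsevichZagierPeriods.KontsevichZagierPeriods.Theorems.TorsionLogsNeronTorsionSectorStubLogStep
import Literature.NumberTheory.Transcendental.KZLogCalculusProofs
import HarnessLib

/-!
# Stub `stub_logA` — crux `TorsionLogs.NeronTorsionSector`, line `registered` (block V5):
# the hard log at the corner `O` (point at infinity), lower side

On the identity component of the real cubic `y² = f(x) = 4x³ − g₂x − g₃` the row-1 third-kind
representation `Θ₁ = [(x₂, x₁), Qf/√f dx]` (x-chart) and the row-0 representation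
`Θ₀ = [(0, s₁), Qh(s)·2/R(s) ds]`, written in the compactifying chart `s = x^{-1/2}` at the point
at infinity (`Qh s = Qf(s⁻²)`, `R s = s³√f(s⁻²)`, `s₁² x₁ = 1`), differ modulo `KZ.relations` by
a `ℤ`-combination of interval log carriers `[(αᵢ, βᵢ), dt/t]` whose values add up to
`log |Gs s₁| − log |Gs 0|`, `Gs(s) = G(s⁻²)` being the chart dlog potential.

The chain of moves (the pattern of `stub_logStep`):
1. rule (2) along the chart translation `τh : (0, s₁) → (x₂, x₁)` (injective, with the chart
   Haar identity `|τh′|·R = 2√f∘τh`): `Θ₁ ≡ r₀ = [(0,s₁), Qf(τh s)·2/R(s)]`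
   (`of_sub_of_mem_relations_of_cov_fin_one`; the absolute convergence of `r₀` is transported
   from that of `Θ₁` by `MeasureTheory.integrableOn_image_iff_integrableOn_abs_det_fderiv_smul`);
2. integrand additivity: `r₀ − Θ₀ ≡ rD = [(0,s₁), 2(Qf∘τh − Qh)/R]`;
3. chain rule: on `(0, s₁)` the integrand of `rD` is `Gs′/Gs` (from the x-chart identity
   `G′ = G·(Qf∘τ − Qf)/yb`, `yb = −√f = −R/s³` at `x = s⁻² > x₁`);
4. `Gs` has constant sign `σ` on `[0, s₁]`, `|Gs| = σGs`, and the landed `stub_dlogUnfold`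
   applied to `[(0,s₁), (σGs)′/(σGs)] = rD` unfolds it into interval log carriers with values
   summing to `log (|Gs s₁| / |Gs 0|)`.

References: M. Kontsevich, D. Zagier, *Periods* (2001), §1.2 rules (1)–(3); J. H. Silverman,
*The Arithmetic of Elliptic Curves* (2nd ed., 2009), III.5 (invariant differential).
-/

noncomputable section

-- `Summit.KontsevichZagierPeriods.KontsevichZagierPeriods.…` is the tree's mandated layout (single-conjunct summit).
set_option linter.dupNamespace false

open Set MeasureTheory Filter Topology
open Literature.NumberTheory.Transcendental Literature.ModelTheory.ExponentialFields
open Summit.KontsevichZagierPeriods.HyperbolicBloch.OffTetraSectorKernel (isSemialgebraic_logIvl)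
open Summit.KontsevichZagierPeriods.HermiteRigidity.GenusTwoCycleTransfer (hasFDerivAt_fin_one
  det_smul_id_fin_one)

namespace Summit.KontsevichZagierPeriods.KontsevichZagierPeriods.Cruxes.NeronTorsionSector.Translation

/-- **Chain rule in the chart `s = x^{-1/2}` at the point at infinity.** If `Gs s = G(s⁻²)`,
`τh s = τ(s⁻²)`, `Qh s = Qf(s⁻²)` and `√f(s⁻²) = R s / s³` on `(0, s₁]`, `yb = −√f`, `s₁² x₁ = 1`,
and `G′ = G·(Qf∘τ − Qf)/yb` on `(x₁, ∞)`, then on `(0, s₁)` the chart potential satisfies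
`Gs′ = Gs · 2(Qf∘τh − Qh)/R` (`d(s⁻²)/ds = −2/s³`). [cite: KontsevichZagier2001, §1.2 rule (2)] -/
theorem logA_hasDerivAt_chart {x₁ s₁ : ℝ} {f yb τ Qf G R τh Qh Gs : ℝ → ℝ}
    (hs₁ : 0 < s₁) (hsx : s₁ ^ 2 * x₁ = 1) (hyb : yb = fun x => -Real.sqrt (f x))
    (hchart : ∀ s, 0 < s → s ≤ s₁ →
      Real.sqrt (f (s ^ 2)⁻¹) = R s / s ^ 3 ∧ τh s = τ (s ^ 2)⁻¹ ∧ Qh s = Qf (s ^ 2)⁻¹ ∧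
        Gs s = G (s ^ 2)⁻¹)
    (hRpos : ∀ s ∈ Icc 0 s₁, 0 < R s)
    (hGd : ∀ x, x₁ < x → HasDerivAt G (G x * ((Qf (τ x) - Qf x) / yb x)) x)
    {s : ℝ} (hs : s ∈ Ioo 0 s₁) :
    HasDerivAt Gs (Gs s * (2 * (Qf (τh s) - Qh s) / R s)) s := by
  have hs0 : 0 < s := hs.1
  have hybx : ∀ x, yb x = -Real.sqrt (f x) := fun x => by rw [hyb]
  have hx : x₁ < (s ^ 2)⁻¹ := by
    rw [eq_inv_of_mul_eq_one_right hsx]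
    exact (inv_lt_inv₀ (pow_pos hs₁ 2) (pow_pos hs0 2)).2 (pow_lt_pow_left₀ hs.2 hs0.le two_ne_zero)
  obtain ⟨hsq, hτ, hQ, hG⟩ := hchart s hs0 hs.2.le
  have hinner : HasDerivAt (fun y : ℝ => (y ^ 2)⁻¹) (-2 / s ^ 3) s := by
    have h : HasDerivAt (fun y : ℝ => (y ^ 2)⁻¹) (-(((2 : ℕ) : ℝ) * s ^ (2 - 1)) / (s ^ 2) ^ 2) s :=
      (hasDerivAt_pow 2 s).inv (pow_ne_zero 2 hs0.ne')
    refine h.congr_deriv ?_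
    have hs0' : s ≠ 0 := hs0.ne'
    push_cast
    field_simp
  have hcomp := (hGd _ hx).comp s hinner
  have hev : Gs =ᶠ[𝓝 s] (G ∘ fun y : ℝ => (y ^ 2)⁻¹) := by
    filter_upwards [Ioo_mem_nhds hs.1 hs.2] with y hy
    exact (hchart y hy.1 hy.2.le).2.2.2
  refine (hcomp.congr_of_eventuallyEq hev).congr_deriv ?_
  have hR0 : R s ≠ 0 := (hRpos s ⟨hs0.le, hs.2.le⟩).ne'
  have hs0' : s ≠ 0 := hs0.ne'
  rw [← hG, ← hτ, ← hQ, hybx, hsq]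
  field_simp

/-- **STUB V5 (`stub_logA`, size L) — the hard log at the corner, lower side: `θ̃₁ − θ̃₀ ≡ ∫ dlog`.** In the
chart `s = x^{-1/2}` the row-0 third-kind rep is `Θ̂₀ = [(0,s₁), Q̂(s)·2/R(s) ds]` (`Q̂ = Qf(s⁻²)` regularised,
`stub_cornerChartLower`), and `Θ₁ = [(x₂,x₁), Qf/√f]` pulls back along the chart translation `τ̂ : (0,s₁) → (x₂,x₁)`
(rule (2), chart Haar identity `|τ̂′|R = 2√f∘τ̂`) to `[(0,s₁), Qf(τ̂ s)·2/R(s)]`; the difference integrand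
`2(Qf∘τ̂ − Q̂)/R` is `Ĝ′/Ĝ` for the chart dlog potential `Ĝ(s) = G(s⁻²)` (chain rule from the x-chart identity
`G′ = G·(Qf∘τ − Qf)/yb`, `yb = −R/s³`), continuous and non-vanishing on `[0, s₁]`; `stub_dlogUnfold` on `|Ĝ|`
unfolds it. [cite: KontsevichZagier2001, §1.2 rules (2),(3)] -/
theorem stub_logA : ∀ (g₂ g₃ x₁ x₂ s₁ : ℝ) (f yb τ Qf G R τh τh' Qh Gs : ℝ → ℝ)
      (Θ₁ Θ₀ : Literature.NumberTheory.Transcendental.KZ.IntegralRep 1),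
    (∀ x, f x = 4 * x ^ 3 - g₂ * x - g₃) →
    IsAlgebraic ℚ g₂ → IsAlgebraic ℚ g₃ → IsAlgebraic ℚ x₁ → IsAlgebraic ℚ x₂ → IsAlgebraic ℚ s₁ →
    0 < x₂ → x₂ < x₁ → 0 < s₁ → s₁ ^ 2 * x₁ = 1 → (∀ x, x₂ ≤ x → 0 < f x) →
    yb = (fun x => -Real.sqrt (f x)) →
    (∀ s, 0 < s → s ≤ s₁ →
      Real.sqrt (f (s ^ 2)⁻¹) = R s / s ^ 3 ∧ τh s = τ (s ^ 2)⁻¹ ∧ Qh s = Qf (s ^ 2)⁻¹ ∧ Gs s = G (s ^ 2)⁻¹) →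
    (∀ s ∈ Set.Icc 0 s₁, 0 < R s) → ContinuousOn R (Set.Icc 0 s₁) →
    IsSemialgebraicFunOn ℚ {t : Fin 1 → ℝ | t 0 ∈ Set.Icc 0 s₁} (fun t => R (t 0)) →
    (∀ s ∈ Set.Ioo 0 s₁, HasDerivAt τh (τh' s) s ∧ τh' s ≠ 0 ∧
      |τh' s| * R s = 2 * Real.sqrt (f (τh s)) ∧ τh s ∈ Set.Ioo x₂ x₁) →
    Set.InjOn τh (Set.Ioo 0 s₁) → τh '' Set.Ioo 0 s₁ = Set.Ioo x₂ x₁ →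
    ContinuousOn τh (Set.Icc 0 s₁) → Set.MapsTo τh (Set.Icc 0 s₁) (Set.Icc x₂ x₁) →
    IsSemialgebraicFunOn ℚ {t : Fin 1 → ℝ | t 0 ∈ Set.Icc 0 s₁} (fun t => τh (t 0)) →
    ContinuousOn Qf (Set.Icc x₂ x₁) →
    IsSemialgebraicFunOn ℚ {t : Fin 1 → ℝ | t 0 ∈ Set.Icc x₂ x₁} (fun t => Qf (t 0)) →
    IsSemialgebraicFunOn ℚ {t : Fin 1 → ℝ | t 0 ∈ Set.Icc 0 s₁} (fun t => Qf (τh (t 0))) →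
    ContinuousOn Qh (Set.Icc 0 s₁) →
    IsSemialgebraicFunOn ℚ {t : Fin 1 → ℝ | t 0 ∈ Set.Icc 0 s₁} (fun t => Qh (t 0)) →
    (∀ x, x₁ < x → HasDerivAt G (G x * ((Qf (τ x) - Qf x) / yb x)) x) →
    ContinuousOn Gs (Set.Icc 0 s₁) → (∀ s ∈ Set.Icc 0 s₁, Gs s ≠ 0) →
    IsSemialgebraicFunOn ℚ {t : Fin 1 → ℝ | t 0 ∈ Set.Icc 0 s₁} (fun t => Gs (t 0)) →
    Θ₁.domain = {t | x₂ < t 0 ∧ t 0 < x₁} →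
    Set.EqOn Θ₁.integrand (fun t => Qf (t 0) / Real.sqrt (f (t 0))) Θ₁.domain →
    Θ₀.domain = {t | 0 < t 0 ∧ t 0 < s₁} →
    Set.EqOn Θ₀.integrand (fun t => Qh (t 0) * (2 / R (t 0))) Θ₀.domain →
    ∃ (κ : ℕ) (α β : Fin κ → ℝ) (ε : Fin κ → ℤ)
      (cs : Fin κ → Literature.NumberTheory.Transcendental.KZ.IntegralRep 1),
      (∀ i, 0 < α i ∧ α i ≤ β i ∧ IsAlgebraic ℚ (α i) ∧ IsAlgebraic ℚ (β i) ∧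
        (cs i).domain = {t | α i < t 0 ∧ t 0 < β i} ∧
        Set.EqOn (cs i).integrand (fun t => 1 / t 0) (cs i).domain) ∧
      ∑ i, (ε i : ℝ) * Real.log (β i / α i) = Real.log |Gs s₁| - Real.log |Gs 0| ∧
      Literature.NumberTheory.Transcendental.KZ.of Θ₁ - Literature.NumberTheory.Transcendental.KZ.of Θ₀
        - ∑ i, ε i • Literature.NumberTheory.Transcendental.KZ.of (cs i) ∈
        Literature.NumberTheory.Transcendental.KZ.relations := by
  intro g₂ g₃ x₁ x₂ s₁ f yb τ Qf G R τh τh' Qh Gs Θ₁ Θ₀ _hf _h₂ _h₃ _hx₁a _hx₂a hs₁a _hx₂0 _hx₂₁ hs₁0 hsx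
    hfpos hyb hchart hRpos _hRc hRσ hτh hinjτ hτimg _hτc _hτmaps hτσ _hQfc _hQfσ hQfτσ _hQhc hQhσ hGd
    hGsc hGs0 hGsσ hΘ₁d hΘ₁i hΘ₀d hΘ₀i
  /- ## Pointwise facts along the chart translation -/
  have hτd : ∀ s ∈ Ioo 0 s₁, HasDerivAt τh (τh' s) s := fun s hs => (hτh s hs).1
  have hτI : ∀ s ∈ Ioo 0 s₁, τh s ∈ Ioo x₂ x₁ := fun s hs => (hτh s hs).2.2.2
  have hRne' : ∀ s ∈ Ioo 0 s₁, R s ≠ 0 := fun s hs => (hRpos s ⟨hs.1.le, hs.2.le⟩).ne'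
  have hsqrtτ_ne : ∀ s ∈ Ioo 0 s₁, Real.sqrt (f (τh s)) ≠ 0 := fun s hs =>
    (Real.sqrt_pos.2 (hfpos _ (hτI s hs).1.le)).ne'
  -- the chart Haar identity `|τh′| = 2√f∘τh / R`
  have habsτ : ∀ s ∈ Ioo 0 s₁, |τh' s| = 2 * Real.sqrt (f (τh s)) / R s := fun s hs => by
    rw [eq_div_iff (hRne' s hs)]
    exact (hτh s hs).2.2.1
  /- ## The slab `S = (0, s₁)` of `ℝ¹` and the semialgebraic functions on it -/
  set S : Set (Fin 1 → ℝ) := {t | 0 < t 0 ∧ t 0 < s₁} with hS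
  have hSσ : IsSemialgebraic ℚ S := isSemialgebraic_logIvl isAlgebraic_zero hs₁a
  have hmeas : MeasurableSet S := IsSemialgebraic.measurableSet_holds hSσ
  have hTσ : IsSemialgebraic ℚ {t : Fin 1 → ℝ | t 0 ∈ Icc 0 s₁} :=
    IsSemialgebraicFunOn.isSemialgebraic_holds hGsσ
  have hST : S ⊆ {t : Fin 1 → ℝ | t 0 ∈ Icc 0 s₁} := fun t ht => ⟨le_of_lt ht.1, le_of_lt ht.2⟩
  have hRne : ∀ p ∈ S, R (p 0) ≠ 0 := fun p hp => hRne' (p 0) hp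
  have hΘ₁i' : ∀ p ∈ S, Θ₁.integrand (fun _ => τh (p 0)) =
      Qf (τh (p 0)) / Real.sqrt (f (τh (p 0))) := fun p hp =>
    hΘ₁i (by rw [hΘ₁d]; exact hτI (p 0) hp)
  have hΘ₀i' : ∀ p ∈ S, Θ₀.integrand p = Qh (p 0) * (2 / R (p 0)) := fun p hp =>
    hΘ₀i (by rw [hΘ₀d]; exact hp)
  have h2 : IsSemialgebraicFunOn ℚ S (fun _ => (2 : ℝ)) :=
    (isSemialgebraicFunOn_ratCast hSσ 2).congr fun x _ => by norm_num
  have hτS : IsSemialgebraicFunOn ℚ S (fun t => τh (t 0)) := hτσ.mono hST hSσ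
  have hRS : IsSemialgebraicFunOn ℚ S (fun t => R (t 0)) := hRσ.mono hST hSσ
  have hQfτS : IsSemialgebraicFunOn ℚ S (fun t => Qf (τh (t 0))) := hQfτσ.mono hST hSσ
  have hQhS : IsSemialgebraicFunOn ℚ S (fun t => Qh (t 0)) := hQhσ.mono hST hSσ
  have hGsS : IsSemialgebraicFunOn ℚ S (fun t => Gs (t 0)) := hGsσ.mono hST hSσ
  /- ## Step 1: the pulled-back representation `r₀ = [(0,s₁), Qf(τh s)·2/R(s)]` and rule (2) -/
  have hr₀σ : IsSemialgebraicFunOn ℚ S (fun p => Qf (τh (p 0)) * (2 / R (p 0))) :=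
    IsSemialgebraicFunOn.mul_holds hQfτS (h2.div hRS hRne)
  have hinjΦ : InjOn (fun (p : Fin 1 → ℝ) (_ : Fin 1) => τh (p 0)) S := fun p hp q hq h => by
    have h0 : τh (p 0) = τh (q 0) := congr_fun h 0
    funext i
    rw [Fin.fin_one_eq_zero i]
    exact hinjτ hp hq h0
  have himg : (fun (p : Fin 1 → ℝ) (_ : Fin 1) => τh (p 0)) '' S = Θ₁.domain := by
    rw [hΘ₁d]
    exact image_slab_eq hτimg
  have hr₀_int : IntegrableOn (fun p : Fin 1 → ℝ => Qf (τh (p 0)) * (2 / R (p 0))) S := by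
    have key : IntegrableOn Θ₁.integrand ((fun (p : Fin 1 → ℝ) (_ : Fin 1) => τh (p 0)) '' S) := by
      rw [himg]
      exact Θ₁.integrableOn
    have key' := (integrableOn_image_iff_integrableOn_abs_det_fderiv_smul volume hmeas
      (f' := fun p : Fin 1 → ℝ => (τh' (p 0)) • ContinuousLinearMap.id ℝ (Fin 1 → ℝ))
      (fun p hp => (hasFDerivAt_fin_one τh (τh' (p 0)) p (hτd (p 0) hp)).hasFDerivWithinAt)
      hinjΦ Θ₁.integrand).1 key
    refine key'.congr_fun (fun p hp => ?_) hmeas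
    show |((τh' (p 0)) • ContinuousLinearMap.id ℝ (Fin 1 → ℝ)).det| •
        Θ₁.integrand (fun _ => τh (p 0)) = Qf (τh (p 0)) * (2 / R (p 0))
    have h₁ := hsqrtτ_ne (p 0) hp
    have h₂ := hRne p hp
    rw [det_smul_id_fin_one, smul_eq_mul, habsτ _ hp, hΘ₁i' p hp]
    field_simp
  obtain ⟨r₀, hr₀d, hr₀i⟩ : ∃ r : KZ.IntegralRep 1, r.domain = S ∧
      r.integrand = fun p => Qf (τh (p 0)) * (2 / R (p 0)) :=
    ⟨⟨S, fun p => Qf (τh (p 0)) * (2 / R (p 0)), hSσ, hr₀σ, hr₀_int⟩, rfl, rfl⟩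
  have hA : KZ.of r₀ - KZ.of Θ₁ ∈ KZ.relations := by
    refine of_sub_of_mem_relations_of_cov_fin_one (I := Ioo 0 s₁) r₀ Θ₁ hr₀d
      (by rw [hr₀d]; exact hτS) hτd hinjτ (by rw [hΘ₁d, hτimg]; rfl) fun p hp => ?_
    rw [hr₀d] at hp
    have h₁ := hsqrtτ_ne (p 0) hp
    have h₂ := hRne p hp
    rw [hr₀i, hΘ₁i' p hp, habsτ _ hp]
    field_simp
  /- ## Step 2: integrand additivity, `r₀ − Θ₀ ≡ rD = [(0,s₁), 2(Qf∘τh − Qh)/R]` -/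
  have hDσ : IsSemialgebraicFunOn ℚ S (fun p => 2 * (Qf (τh (p 0)) - Qh (p 0)) / R (p 0)) :=
    (IsSemialgebraicFunOn.mul_holds h2 (IsSemialgebraicFunOn.sub_holds hQfτS hQhS)).div hRS hRne
  have hD_int : IntegrableOn
      (fun p : Fin 1 → ℝ => 2 * (Qf (τh (p 0)) - Qh (p 0)) / R (p 0)) S := by
    have h₀ : IntegrableOn Θ₀.integrand S := by
      have h := Θ₀.integrableOn
      rwa [hΘ₀d] at h
    refine (hr₀_int.sub h₀).congr_fun (fun p hp => ?_) hmeas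
    rw [Pi.sub_apply, hΘ₀i' p hp]
    ring
  obtain ⟨rD, hrDd, hrDi⟩ : ∃ r : KZ.IntegralRep 1, r.domain = S ∧
      r.integrand = fun p => 2 * (Qf (τh (p 0)) - Qh (p 0)) / R (p 0) :=
    ⟨⟨S, _, hSσ, hDσ, hD_int⟩, rfl, rfl⟩
  have hB : KZ.of r₀ - KZ.of Θ₀ - KZ.of rD ∈ KZ.relations := by
    refine KZ.integrandAddRel_subset_relations ⟨1, r₀, Θ₀, rD, by rw [hΘ₀d, hr₀d],
      by rw [hrDd, hr₀d], fun p hp => ?_, rfl⟩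
    rw [hr₀d] at hp
    rw [Pi.add_apply, hr₀i, hrDi, hΘ₀i' p hp]
    ring
  /- ## Step 3: `rD = [(0,s₁), (σGs)′/(σGs)]` unfolds into interval logarithms -/
  obtain ⟨σ, hσ1, hσpos⟩ := logStep_sign hs₁0.le hGsc hGs0
  have hσalg : IsAlgebraic ℚ σ := by
    rcases hσ1 with rfl | rfl
    · exact isAlgebraic_one
    · exact isAlgebraic_one.neg
  have hσabs : |σ| = 1 := by rcases hσ1 with rfl | rfl <;> simp
  have habs : ∀ x ∈ Icc 0 s₁, |Gs x| = σ * Gs x := fun x hx => by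
    have h := abs_of_pos (hσpos x hx)
    rwa [abs_mul, hσabs, one_mul] at h
  have hGpσ : IsSemialgebraicFunOn ℚ {t : Fin 1 → ℝ | t 0 ∈ Icc 0 s₁} (fun t => σ * Gs (t 0)) :=
    IsSemialgebraicFunOn.mul_holds (isSemialgebraicFunOn_const_of_isAlgebraic hTσ hσalg) hGsσ
  have hGp'σ : IsSemialgebraicFunOn ℚ S
      (fun t => σ * (Gs (t 0) * (2 * (Qf (τh (t 0)) - Qh (t 0)) / R (t 0)))) :=
    IsSemialgebraicFunOn.mul_holds (isSemialgebraicFunOn_const_of_isAlgebraic hSσ hσalg)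
      (IsSemialgebraicFunOn.mul_holds hGsS hDσ)
  have hGppos : ∀ x ∈ Icc 0 s₁, 0 < σ * Gs x := hσpos
  have hGpc : ContinuousOn (fun x => σ * Gs x) (Icc 0 s₁) := continuousOn_const.mul hGsc
  have hGpd : ∀ x ∈ Ioo 0 s₁,
      HasDerivAt (fun x => σ * Gs x) (σ * (Gs x * (2 * (Qf (τh x) - Qh x) / R x))) x :=
    fun x hx => (logA_hasDerivAt_chart hs₁0 hsx hyb hchart hRpos hGd hx).const_mul σ
  have hrDd' : rD.domain = {t | 0 < t 0 ∧ t 0 < s₁} := hrDd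
  have hrDi' : EqOn rD.integrand
      (fun t => σ * (Gs (t 0) * (2 * (Qf (τh (t 0)) - Qh (t 0)) / R (t 0))) / (σ * Gs (t 0)))
      rD.domain := fun p hp => by
    rw [hrDd] at hp
    have hσG : σ * Gs (p 0) ≠ 0 := (hσpos (p 0) ⟨le_of_lt hp.1, le_of_lt hp.2⟩).ne'
    rw [hrDi]
    show 2 * (Qf (τh (p 0)) - Qh (p 0)) / R (p 0) =
      σ * (Gs (p 0) * (2 * (Qf (τh (p 0)) - Qh (p 0)) / R (p 0))) / (σ * Gs (p 0))
    rw [← mul_assoc, mul_div_cancel_left₀ _ hσG]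
  obtain ⟨κ, α, β, ε, cs, hcs, hlog, hrel⟩ := stub_dlogUnfold 0 s₁ (fun x => σ * Gs x)
    (fun x => σ * (Gs x * (2 * (Qf (τh x) - Qh x) / R x))) rD hs₁0 isAlgebraic_zero hs₁a hGppos
    hGpc hGpd hGpσ hGp'σ hrDd' hrDi'
  /- ## Step 4: assemble -/
  refine ⟨κ, α, β, ε, cs, hcs, ?_, ?_⟩
  · have h0 : (0 : ℝ) ∈ Icc 0 s₁ := left_mem_Icc.2 hs₁0.le
    have h1 : s₁ ∈ Icc 0 s₁ := right_mem_Icc.2 hs₁0.le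
    rw [hlog]
    show Real.log (σ * Gs s₁ / (σ * Gs 0)) = Real.log |Gs s₁| - Real.log |Gs 0|
    rw [Real.log_div (hσpos s₁ h1).ne' (hσpos 0 h0).ne', habs s₁ h1, habs 0 h0]
  · have e : KZ.of Θ₁ - KZ.of Θ₀ - ∑ i, ε i • KZ.of (cs i) =
        (KZ.of r₀ - KZ.of Θ₀ - KZ.of rD) - (KZ.of r₀ - KZ.of Θ₁)
          + (KZ.of rD - ∑ i, ε i • KZ.of (cs i)) := by
      abel
    rw [e]
    exact KZ.relations.add_mem (KZ.relations.sub_mem hB hA) hrel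

end Summit.KontsevichZagierPeriods.KontsevichZagierPeriods.Cruxes.NeronTorsionSector.Translation

end
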